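import Summits.AtomisticToContinuum.FouriersLaw.Theorems.BondHeatUncertaintyExtensiveSnapshotIrreversibilityEnergyWindowHessianSplitD

/-!
# Bond heat uncertainty — node «HessianSplit», part E: the reductions (MD₂) ⟹ (KD₂) and
  (MW₂) ⟹ (MD₂); junctions

CONTENTS (statements (MD₂) `DensityScoreDualBound₂`, (MW₂) `MalliavinIBPWeights₂` and the calculus
lemmas are in part D).
* ★ `lyapunovWeightedDensitySobolev₂_of_scoreDual : (MD₂) → (KD₂)` — PROVED: for `θ₁ < θ₂ < 1/T`
  take `r = θ₂/θ₁`, `ε = θ₂ − θ₁` in (MD₂) and test with the SMOOTH compactly supported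
  `G_η = χ_n e^{θ₁H} Dᵢ/√(Dᵢ²+η²)` (`χ_n` the tree's cutoff `ewCutoff`, `= 1` on `|y| ≤ n`): by
  `|t| ≤ t²/√(t²+η²) + η`, `∫_{|y|≤n} e^{θ₁H}|Dᵢ| ≤ ∫ G_η Dᵢ + η ∫ χ_n e^{θ₁H}`, and `∫ |G_η|^r p dy
  ≤ ∫ e^{θ₂H} dP_s(z,·) ≤ e^{2γTθ₂s} e^{θ₂H(z)}` is CEHR (3.4) (tree); `η ↓ 0`, then monotone
  convergence `n → ∞`.  ALL exponents `r ↓ 1` (all moments `q < ∞` of the weights) are consumed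
  as `θ₁ ↑ θ₂` ("type it so").  The regularisation lives HERE, so the leaf (MD₂) needs smooth test
  functions only.
* ★ `densityScoreDualBound₂_of_malliavinWeights : (MW₂) → (MD₂)` — PROVED (Hölder on the tree's
  Wiener pair): `|∫ G Dᵢ dy| = |E[G(X_s^z)Φᵢ]| ≤ (E|G(X_s^z)|^r)^{1/r} ‖Φᵢ‖_q = (∫ |G|^r p(s,z,y)
  dy)^{1/r} ‖Φᵢ‖_q`, `r = q/(q−1)`, the last step because `law X_s^z = P_s(z,·) = p(s,z,y) dy`
  (`pinnedChain_transitionKernel_apply`, `IsTransitionDensity.kernel_eq`).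
* ★★ `kernelTemperatureLipschitz_of_scoreDual : (Dˢ) → (MD₂) → S3` (proposed junction of record),
  `snapshotKLUpperExpansion_of_atoms₆SD`, and through (MW₂): `lyapunovWeightedDensitySobolev₂_of
  _malliavinWeights`, `kernelTemperatureLipschitz_of_malliavinWeights : (Dˢ) → (MW₂) → S3`,
  `snapshotKLUpperExpansion_of_atoms₆MW : A0 → A2 → (Dˢ) → (MW₂) → A3p → A4 → K_fix`.
Hence the chain of typed leaves beneath S3 after g82, every arrow kernel-checked (parts E, C, B,
main):  (MW₂) ⟹ (MD₂) ⟹ (KD₂) ⟹ (G2) ∧ (G12*ᶜᶜ) ⟹ (G2) ∧ (G2*) ⟹ [with (Dˢ)] S3.  The converse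
(MD₂) ⟹ (MW₂) (`Φᵢ := (Dᵢ/p)(s,z,X_s^z)`, Riesz) is true and not needed.
-/

noncomputable section

namespace Summit.AtomisticToContinuum.FouriersLaw.Theorems.ExtensiveSnapshotIrreversibility.EnergyWindow

open MeasureTheory Filter Topology Real Set Metric
open scoped ENNReal NNReal ContDiff
open Literature.MathematicalPhysics.KineticTheory.HeatConduction Literature.Probability.Process
open Literature.Analysis.FunctionSpaces

variable {N : ℕ}

/-! ## 1. ★ (MD₂) ⟹ (KD₂): smooth duality, CEHR (3.4), `η ↓ 0`, exhaustion -/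

/-- **★ (MD₂) ⟹ (KD₂).**  For `0 < θ₁ < θ₂ < 1/T` use (MD₂) with `r = θ₂/θ₁`, `ε = θ₂ − θ₁`;
test with the smooth compactly supported `G_η = χ_n e^{θ₁H} Dᵢ/√(Dᵢ²+η²)` (`χ_n = 1` on `|y| ≤ n`):
since `|t| ≤ t²/√(t²+η²) + η`, `∫_{|y|≤n} e^{θ₁H}|Dᵢ| ≤ ∫ G_η Dᵢ + η ∫ χ_n e^{θ₁H} ≤ (∫|G_η|^r p
dy)^{1/r} C e^{εH(z)} + η M_n` and `∫ |G_η|^r p dy ≤ ∫ e^{θ₂H} dP_s(z,·) ≤ e^{2γTθ₂s} e^{θ₂H(z)}`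
(CEHR (3.4), tree); let `η ↓ 0`, then `n → ∞`.
[cite: CuneoEckmannHairerReyBellet2018, §3 eq. (3.4)] -/
theorem lyapunovWeightedDensitySobolev₂_of_scoreDual (hSD : DensityScoreDualBound₂) :
    LyapunovWeightedDensitySobolev₂ := by
  intro ω₂ lam β γ hω hl hβ hγ T hT N hN θ₁ θ₂ hθ₁ hθ₁₂ hθ₂
  have hθ₂0 : 0 < θ₂ := hθ₁.trans hθ₁₂
  have hgap : 0 < θ₂ - θ₁ := sub_pos.2 hθ₁₂
  set r : ℝ := θ₂ / θ₁ with hr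
  have hr1 : 1 < r := (one_lt_div hθ₁).2 hθ₁₂
  have hr0 : 0 < r := one_pos.trans hr1
  obtain ⟨δ₀, C, hδ₀, hC0, hW⟩ := hSD ω₂ lam β γ hω hl hβ hγ T hT N hN r (θ₂ - θ₁) hr1 hgap
  -- shrink `δ₀`: both temperatures positive and `θ₂ < 1/max(T ± δ/2)`
  have hTθ : θ₂ * T < 1 := by rwa [lt_div_iff₀ hT] at hθ₂
  have hg : 0 < 1 / θ₂ - T := by
    rw [sub_pos, lt_div_iff₀ hθ₂0]; linarith
  set H := (pinnedChain ω₂ lam β γ).hamiltonian N with hH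
  set B : ℝ := Real.exp (2 * γ * T * θ₁) * C with hBdef
  refine ⟨min δ₀ (min T (1 / θ₂ - T)), 4 * B, lt_min hδ₀ (lt_min hT hg),
    fun δ hδ p hp s hs hs1 b hb z => ?_⟩
  have hδ₀' : |δ| < δ₀ := lt_of_lt_of_le hδ (min_le_left _ _)
  have hδT : |δ| < T := lt_of_lt_of_le hδ ((min_le_right _ _).trans (min_le_left _ _))
  have hδg : |δ| < 1 / θ₂ - T := lt_of_lt_of_le hδ ((min_le_right _ _).trans (min_le_right _ _))
  obtain ⟨⟨hδ1, hδ2⟩, hδ3, hδ4⟩ := And.intro (abs_lt.1 hδT) (abs_lt.1 hδg)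
  have hL : 0 < T + δ / 2 := by linarith
  have hR : 0 < T - δ / 2 := by linarith
  have hm0 : 0 < max (T + δ / 2) (T - δ / 2) := lt_max_iff.2 (Or.inl hL)
  have hm : max (T + δ / 2) (T - δ / 2) < 1 / θ₂ := max_lt (by linarith) (by linarith)
  have hθmax : θ₂ < 1 / max (T + δ / 2) (T - δ / 2) := by
    rw [lt_div_iff₀ hm0]
    calc θ₂ * max (T + δ / 2) (T - δ / 2) < θ₂ * (1 / θ₂) := mul_lt_mul_of_pos_left hm hθ₂0
      _ = 1 := mul_one_div_cancel hθ₂0.ne'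
  have hs0 : 0 < s := by linarith
  have hN0 : 0 < N := by omega
  have hW' := hW δ hδ₀' p hp s hs hs1 b hb z
  -- the kernel at time `s` from `z`: density `p(s,z,·)`, CEHR (3.4)
  set μ := (pinnedChain ω₂ lam β γ).transitionKernel N (T + δ / 2) (T - δ / 2) s.toNNReal z
    with hμ
  have hk : μ = volume.withDensity fun y => ENNReal.ofReal (p s z y) := hp.kernel_eq hs0 z
  have hpm : Measurable (p s z) := (hp.contDiff_right hs0 z).continuous.measurable
  have hp0 : ∀ y, 0 ≤ p s z y := hp.2.1 s hs0 z
  have hHc : Continuous H := pinnedChain_continuous_hamiltonian ω₂ lam β γ N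
  have hE₁c : Continuous fun y => Real.exp (θ₁ * H y) := (continuous_const.mul hHc).rexp
  have hE₂m : Measurable fun y => Real.exp (θ₂ * H y) := (continuous_const.mul hHc).rexp.measurable
  have hpow : ∀ y, Real.exp (θ₁ * H y) ^ r = Real.exp (θ₂ * H y) := fun y => by
    rw [← Real.exp_mul]; congr 1; rw [hr]; field_simp
  obtain ⟨hwi, hwb⟩ := integrable_and_abs_integral_transitionKernel_le hω hl hβ hγ hN0 hL hR hθ₂0
    hθmax s.toNNReal z zero_le_one hE₂m (fun y => by rw [one_mul, abs_of_pos (Real.exp_pos _)])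
  simp only [one_mul, Real.coe_toNNReal _ hs0.le] at hwb
  have hwb' : ∫ y, Real.exp (θ₂ * H y) ∂μ ≤ Real.exp (2 * γ * T * θ₂) * Real.exp (θ₂ * H z) := by
    refine (le_abs_self _).trans (hwb.trans (mul_le_mul_of_nonneg_right ?_ (Real.exp_pos _).le))
    refine Real.exp_le_exp.2 ?_
    have h1 : θ₂ * γ * (T + δ / 2 + (T - δ / 2)) * s = (2 * γ * T * θ₂) * s := by ring
    rw [h1]
    exact mul_le_of_le_one_right (by positivity) hs1
  -- `(∫ |G|^r p dy)^{1/r} ≤ e^{2γTθ₁} e^{θ₁H(z)}` whenever `|G| ≤ e^{θ₁H}`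
  have hGr : ∀ G : PhaseSpace N → ℝ, Measurable G → (∀ y, |G y| ≤ Real.exp (θ₁ * H y)) →
      (∫ y, |G y| ^ r * p s z y) ^ (1 / r) ≤ Real.exp (2 * γ * T * θ₁) * Real.exp (θ₁ * H z) := by
    intro G hGm hG
    have h1 : ∫ y, |G y| ^ r * p s z y = ∫ y, |G y| ^ r ∂μ := by
      rw [hk, integral_withDensity_ofReal_phaseSpace hpm hp0]
      exact integral_congr_ae (ae_of_all _ fun y => mul_comm _ _)
    have h2 : ∫ y, |G y| ^ r ∂μ ≤ ∫ y, Real.exp (θ₂ * H y) ∂μ :=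
      integral_mono_of_nonneg (ae_of_all _ fun y => Real.rpow_nonneg (abs_nonneg _) _) hwi
        (ae_of_all _ fun y => (Real.rpow_le_rpow (abs_nonneg _) (hG y) hr0.le).trans_eq (hpow y))
    have h0 : 0 ≤ ∫ y, |G y| ^ r ∂μ := integral_nonneg fun y => Real.rpow_nonneg (abs_nonneg _) _
    rw [h1]
    refine (Real.rpow_le_rpow h0 (h2.trans hwb') (by positivity)).trans (le_of_eq ?_)
    rw [← Real.exp_add, ← Real.exp_add, ← Real.exp_mul]
    congr 1
    rw [hr]; field_simp
  have hBz : (Real.exp (2 * γ * T * θ₁) * Real.exp (θ₁ * H z)) *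
      (C * Real.exp ((θ₂ - θ₁) * H z)) = B * Real.exp (θ₂ * H z) := by
    rw [hBdef, show θ₂ * H z = θ₁ * H z + (θ₂ - θ₁) * H z by ring, Real.exp_add]; ring
  -- per-term estimate
  have hterm : ∀ i : Fin 4,
      Integrable (fun y => Real.exp (θ₁ * H y) * |densityDeriv p s b z i y|) ∧
        ∫ y, Real.exp (θ₁ * H y) * |densityDeriv p s b z i y| ≤ B * Real.exp (θ₂ * H z) := by
    intro i
    set f := densityDeriv p s b z i with hf
    have hfd : ContDiff ℝ ∞ f := contDiff_densityDeriv hp hs0 b z i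
    have hfc : Continuous f := hfd.continuous
    have hHd : ContDiff ℝ ∞ H := pinnedChain_contDiff_hamiltonian ω₂ lam β γ N
    have hE₁d : ContDiff ℝ ∞ fun y => Real.exp (θ₁ * H y) :=
      Real.contDiff_exp.comp (contDiff_const.mul hHd)
    -- exhaust by balls
    refine integrable_and_integral_le_of_indicator_closedBall (hE₁c.mul hfc.abs)
      (fun y => mul_nonneg (Real.exp_pos _).le (abs_nonneg _)) fun n => ?_
    set K : Set (PhaseSpace N) := closedBall 0 (n : ℝ) with hK
    have hKi : Integrable (K.indicator fun y => Real.exp (θ₁ * H y) * |f y|) :=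
      ((hE₁c.mul hfc.abs).continuousOn.integrableOn_compact
        (isCompact_closedBall _ _)).integrable_indicator measurableSet_closedBall
    -- the smooth cutoff `χ = 1` on `K`, `0 ≤ χ ≤ 1`, compactly supported (tree)
    have hR : (0 : ℝ) < n + 1 := by positivity
    set χ : PhaseSpace N → ℝ := ewCutoff N (n + 1) with hχ
    have hχd : ContDiff ℝ ∞ χ := ewCutoff_contDiff (n := ⊤) _
    have hχK : HasCompactSupport χ := hasCompactSupport_ewCutoff hR
    have hχ0 : ∀ y, 0 ≤ χ y := fun y => ewCutoff_nonneg _ y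
    have hχ1 : ∀ y, χ y ≤ 1 := fun y => ewCutoff_le_one _ y
    have hχK1 : ∀ y ∈ K, χ y = 1 := fun y hy =>
      ewCutoff_eq_one hR (by rw [hK, mem_closedBall_zero_iff] at hy; linarith)
    have hχE : Integrable fun y => χ y * Real.exp (θ₁ * H y) :=
      (hχd.continuous.mul hE₁c).integrable_of_hasCompactSupport hχK.mul_right
    set Mχ : ℝ := ∫ y, χ y * Real.exp (θ₁ * H y) with hMχ
    have hMχ0 : 0 ≤ Mχ := integral_nonneg fun y => mul_nonneg (hχ0 y) (Real.exp_pos _).le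
    -- for every `η > 0`: test with the SMOOTH `G_η = χ e^{θ₁H} f/√(f²+η²)`
    have hη : ∀ η : ℝ, 0 < η → ∫ y, K.indicator (fun y => Real.exp (θ₁ * H y) * |f y|) y ≤
        B * Real.exp (θ₂ * H z) + η * Mχ := by
      intro η hη
      set ψ : ℝ → ℝ := fun t => t / Real.sqrt (t ^ 2 + η ^ 2) with hψ
      have hψd : ContDiff ℝ ∞ ψ := by
        refine contDiff_id.div (((contDiff_id.pow 2).add contDiff_const).sqrt fun t => ?_)
          fun t => ?_
        · exact (by positivity : (0 : ℝ) < id t ^ 2 + η ^ 2).ne'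
        · exact (Real.sqrt_pos.2 (by positivity : (0 : ℝ) < id t ^ 2 + η ^ 2)).ne'
      set G : PhaseSpace N → ℝ := fun y => χ y * (Real.exp (θ₁ * H y) * ψ (f y)) with hGdef
      have hGd : ContDiff ℝ ∞ G := hχd.mul (hE₁d.mul (hψd.comp hfd))
      have hGK : HasCompactSupport G := hχK.mul_right
      have hGle : ∀ y, |G y| ≤ Real.exp (θ₁ * H y) := fun y => by
        rw [hGdef]; dsimp only
        rw [abs_mul, abs_mul, abs_of_nonneg (hχ0 y), abs_of_pos (Real.exp_pos _)]
        calc χ y * (Real.exp (θ₁ * H y) * |ψ (f y)|) ≤ 1 * (Real.exp (θ₁ * H y) * 1) :=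
              mul_le_mul (hχ1 y) (mul_le_mul_of_nonneg_left (abs_le_sgnApprox_mul_add _ hη).2
                (Real.exp_pos _).le) (by positivity) zero_le_one
          _ = Real.exp (θ₁ * H y) := by ring
      -- pointwise: `1_K e^{θ₁H}|f| ≤ G_η f + η χ e^{θ₁H}`
      have hpt : ∀ y, K.indicator (fun y => Real.exp (θ₁ * H y) * |f y|) y ≤
          G y * f y + η * (χ y * Real.exp (θ₁ * H y)) := by
        intro y
        have hψf : 0 ≤ ψ (f y) * f y := by
          rw [hψ]; dsimp only; rw [div_mul_eq_mul_div]
          exact div_nonneg (mul_self_nonneg _) (Real.sqrt_nonneg _)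
        by_cases hy : y ∈ K
        · rw [Set.indicator_of_mem hy]
          have e1 : G y * f y + η * (χ y * Real.exp (θ₁ * H y)) =
              Real.exp (θ₁ * H y) * (ψ (f y) * f y + η) := by
            rw [hGdef]; dsimp only; rw [hχK1 y hy]; ring
          rw [e1]
          exact mul_le_mul_of_nonneg_left (abs_le_sgnApprox_mul_add _ hη).1 (Real.exp_pos _).le
        · rw [Set.indicator_of_notMem hy]
          have e1 : G y * f y = χ y * Real.exp (θ₁ * H y) * (ψ (f y) * f y) := by
            rw [hGdef]; ring
          rw [e1]
          exact add_nonneg (mul_nonneg (mul_nonneg (hχ0 y) (Real.exp_pos _).le) hψf)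
            (mul_nonneg hη.le (mul_nonneg (hχ0 y) (Real.exp_pos _).le))
      have hGfi : Integrable fun y => G y * f y :=
        (hGd.continuous.mul hfc).integrable_of_hasCompactSupport hGK.mul_right
      calc ∫ y, K.indicator (fun y => Real.exp (θ₁ * H y) * |f y|) y
          ≤ ∫ y, (G y * f y + η * (χ y * Real.exp (θ₁ * H y))) :=
            integral_mono hKi (hGfi.add (hχE.const_mul η)) hpt
        _ = (∫ y, G y * f y) + η * Mχ := by
            rw [integral_add hGfi (hχE.const_mul η), integral_const_mul]
        _ ≤ |∫ y, G y * f y| + η * Mχ := by linarith [le_abs_self (∫ y, G y * f y)]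
        _ ≤ (∫ y, |G y| ^ r * p s z y) ^ (1 / r) * (C * Real.exp ((θ₂ - θ₁) * H z)) + η * Mχ := by
            linarith [hW' G hGd hGK i]
        _ ≤ (Real.exp (2 * γ * T * θ₁) * Real.exp (θ₁ * H z)) * (C * Real.exp ((θ₂ - θ₁) * H z)) +
              η * Mχ := by
            linarith [mul_le_mul_of_nonneg_right (hGr G hGd.continuous.measurable hGle)
              (mul_nonneg hC0 (Real.exp_pos ((θ₂ - θ₁) * H z)).le)]
        _ = B * Real.exp (θ₂ * H z) + η * Mχ := by rw [hBz]
    -- `η ↓ 0`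
    refine le_of_forall_pos_le_add fun ε hε => ?_
    have hεM : ε / (Mχ + 1) * Mχ ≤ ε := by
      rw [div_mul_eq_mul_div, div_le_iff₀ (by positivity : (0 : ℝ) < Mχ + 1)]
      nlinarith
    exact (hη (ε / (Mχ + 1)) (by positivity)).trans (by linarith [hεM])
  -- sum the four terms
  have e : (fun y => Real.exp (θ₁ * H y) * densitySobolevSum₂ p s b z y) = fun y =>
      ∑ i, Real.exp (θ₁ * H y) * |densityDeriv p s b z i y| :=
    funext fun y => by rw [densitySobolevSum₂_eq_sum, Finset.mul_sum]
  rw [e]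
  refine ⟨integrable_finsetSum _ fun i _ => (hterm i).1, ?_⟩
  rw [integral_finsetSum _ fun i _ => (hterm i).1]
  calc ∑ i, ∫ y, Real.exp (θ₁ * H y) * |densityDeriv p s b z i y|
      ≤ ∑ _i : Fin 4, B * Real.exp (θ₂ * H z) := Finset.sum_le_sum fun i _ => (hterm i).2
    _ = 4 * B * Real.exp (θ₂ * H z) := by
      rw [Finset.sum_const, Finset.card_univ, Fintype.card_fin, nsmul_eq_mul]; push_cast; ring

/-! ## 2. Junctions through (MD₂) -/

/-- **★★ S3 ⟸ (Dˢ) ∧ (MD₂)**: the kernel temperature-Lipschitz bound from the Duhamel formula and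
the score dual bound. [cite: CuneoEckmannHairerReyBellet2018, Prop. 3.2] -/
theorem kernelTemperatureLipschitz_of_scoreDual (hD : KernelTemperatureDuhamelSmooth)
    (hSD : DensityScoreDualBound₂) : KernelTemperatureLipschitz :=
  kernelTemperatureLipschitz_of_densitySobolev₂ hD
    (lyapunovWeightedDensitySobolev₂_of_scoreDual hSD)

/-- **Junction K_fix ⟸ A0 ∧ A2 ∧ (Dˢ) ∧ (MD₂) ∧ A3p ∧ A4.**
[cite: CuneoEckmannHairerReyBellet2018, Prop. 3.2] -/
theorem snapshotKLUpperExpansion_of_atoms₆SD (h0 : NessGibbsReweighting)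
    (h2 : NessOddLogRatioBound) (hD : KernelTemperatureDuhamelSmooth)
    (hSD : DensityScoreDualBound₂) (h3p : NessFloorMeanValue) (h4 : NessLinearResponseL2) :
    SnapshotKLUpperExpansion :=
  snapshotKLUpperExpansion_of_atoms₆KD h0 h2 hD (lyapunovWeightedDensitySobolev₂_of_scoreDual hSD)
    h3p h4

/-! ## 3. ★ (MW₂) ⟹ (MD₂): Hölder on the Wiener pair and the law of `X_s^z` -/

/-- **★ (MW₂) ⟹ (MD₂).**  With `q = r/(r−1)` conjugate to `r`:
`|∫ G Dᵢ dy| = |E[G(X_s^z)Φᵢ]| ≤ (E|G(X_s^z)|^r)^{1/r} (E|Φᵢ|^q)^{1/q} ≤ (∫|G|^r p(s,z,y)dy)^{1/r}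
C e^{εH(z)}` (`law X_s^z = p(s,z,·)dy`). [cite: Nualart2006, Prop. 2.1.4] -/
theorem densityScoreDualBound₂_of_malliavinWeights (hMW : MalliavinIBPWeights₂) :
    DensityScoreDualBound₂ := by
  intro ω₂ lam β γ hω hl hβ hγ T hT N hN r ε hr hε
  have hr0 : 0 < r := one_pos.trans hr
  -- the conjugate exponent
  set q : ℝ := r / (r - 1) with hq
  have hq1 : 1 < q := by
    rw [hq, one_lt_div (sub_pos.2 hr)]; linarith
  have hq0 : 0 < q := one_pos.trans hq1
  have hpq : r.HolderConjugate q :=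
    Real.holderConjugate_iff.2 ⟨hr, by rw [hq]; field_simp [(sub_pos.2 hr).ne']; ring⟩
  obtain ⟨δ₀, C, hδ₀, hC0, hW⟩ := hMW ω₂ lam β γ hω hl hβ hγ T hT N hN q ε hq1 hε
  refine ⟨δ₀, C, hδ₀, hC0, fun δ hδ p hp s hs hs1 b hb z G hGd hGK i => ?_⟩
  have hs0 : 0 < s := by linarith
  obtain ⟨Φ, hΦ, hid⟩ := hW δ hδ p hp s hs hs1 b hb z
  have hGm : Measurable G := hGd.continuous.measurable
  obtain ⟨M, hM⟩ : ∃ M : ℝ, ∀ y, |G y| ≤ M := by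
    obtain ⟨M, hM⟩ := hGd.continuous.bounded_above_of_compact_support hGK
    exact ⟨M, fun y => (Real.norm_eq_abs _).symm.le.trans (hM y)⟩
  set H := (pinnedChain ω₂ lam β γ).hamiltonian N with hH
  -- the solution map at time `s` from `z`, and its law `p(s,z,y) dy`
  set X : WienerPair → PhaseSpace N := fun w =>
    (pinnedChain ω₂ lam β γ).solMap N (T + δ / 2) (T - δ / 2) s z (pairPath w) with hX
  have hXm : Measurable X :=
    pinnedChain_measurable_solMap_pairPath_right hω hl.le hβ.le hγ.le N (T + δ / 2) (T - δ / 2) s z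
  have hlaw : (pinnedChain ω₂ lam β γ).transitionKernel N (T + δ / 2) (T - δ / 2) s.toNNReal z =
      wienerPair.map X := by
    rw [pinnedChain_transitionKernel_apply hω hl.le hβ.le hγ.le N (T + δ / 2) (T - δ / 2)
      s.toNNReal z, Real.coe_toNNReal _ hs0.le]
  have hpm : Measurable (p s z) := (hp.contDiff_right hs0 z).continuous.measurable
  have hp0 : ∀ y, 0 ≤ p s z y := hp.2.1 s hs0 z
  have hGrm : Measurable fun y => |G y| ^ r := hGm.abs.pow_const r
  have hlawG : ∫ y, |G y| ^ r * p s z y = ∫ w, |G (X w)| ^ r ∂wienerPair := by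
    have h1 : ∫ y, |G y| ^ r * p s z y = ∫ y, |G y| ^ r
        ∂(pinnedChain ω₂ lam β γ).transitionKernel N (T + δ / 2) (T - δ / 2) s.toNNReal z := by
      rw [hp.kernel_eq hs0 z, integral_withDensity_ofReal_phaseSpace hpm hp0]
      exact integral_congr_ae (ae_of_all _ fun y => mul_comm _ _)
    rw [h1, hlaw, integral_map hXm.aemeasurable hGrm.aestronglyMeasurable]
  -- `|G ∘ X| ∈ L^r(Ω)` (bounded), `Φ i ∈ L^q(Ω)`, Hölder
  have hGXm : AEStronglyMeasurable (fun w => |G (X w)|) wienerPair :=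
    (hGm.comp hXm).abs.aestronglyMeasurable
  have hfMem : MemLp (fun w => |G (X w)|) (ENNReal.ofReal r) wienerPair :=
    MemLp.of_bound hGXm M (ae_of_all _ fun w => by
      rw [Real.norm_eq_abs, abs_abs]; exact hM (X w))
  have hΦ1 : Integrable (Φ i) wienerPair :=
    (hΦ i).1.integrable (by rw [← ENNReal.ofReal_one]; exact ENNReal.ofReal_le_ofReal hq1.le)
  have hprod : Integrable (fun w => |G (X w)| * |Φ i w|) wienerPair := by
    exact hΦ1.abs.bdd_mul hGXm (c := M)
      (ae_of_all _ fun w => by rw [Real.norm_eq_abs, abs_abs]; exact hM (X w))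
  have hfac₂ : (∫ w, |Φ i w| ^ q ∂wienerPair) ^ (1 / q) ≤ C * Real.exp (ε * H z) := by
    have h0 : 0 ≤ ∫ w, |Φ i w| ^ q ∂wienerPair :=
      integral_nonneg fun w => Real.rpow_nonneg (abs_nonneg _) _
    refine (Real.rpow_le_rpow h0 (hΦ i).2 (by positivity)).trans (le_of_eq ?_)
    rw [one_div, Real.rpow_rpow_inv (mul_nonneg hC0 (Real.exp_pos _).le) hq0.ne']
  have hholder : ∫ w, |G (X w)| * |Φ i w| ∂wienerPair ≤
      (∫ w, |G (X w)| ^ r ∂wienerPair) ^ (1 / r) * (∫ w, |Φ i w| ^ q ∂wienerPair) ^ (1 / q) :=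
    integral_mul_le_Lp_mul_Lq_of_nonneg hpq (ae_of_all _ fun _ => abs_nonneg _)
      (ae_of_all _ fun _ => abs_nonneg _) hfMem (hΦ i).1.abs
  have h0r : 0 ≤ (∫ w, |G (X w)| ^ r ∂wienerPair) ^ (1 / r) :=
    Real.rpow_nonneg (integral_nonneg fun w => Real.rpow_nonneg (abs_nonneg _) _) _
  calc |∫ y, G y * densityDeriv p s b z i y| = |∫ w, G (X w) * Φ i w ∂wienerPair| := by
        rw [hid G hGd hGK i]
    _ ≤ ∫ w, |G (X w) * Φ i w| ∂wienerPair := abs_integral_le_integral_abs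
    _ = ∫ w, |G (X w)| * |Φ i w| ∂wienerPair :=
        integral_congr_ae (ae_of_all _ fun w => abs_mul _ _)
    _ ≤ (∫ w, |G (X w)| ^ r ∂wienerPair) ^ (1 / r) * (C * Real.exp (ε * H z)) :=
        hholder.trans (mul_le_mul_of_nonneg_left hfac₂ h0r)
    _ = (∫ y, |G y| ^ r * p s z y) ^ (1 / r) * (C * Real.exp (ε * H z)) := by rw [hlawG]

/-! ## 4. Corollaries and junctions through (MW₂) -/

/-- **★ (MW₂) ⟹ (KD₂)** (through (MD₂)). [cite: CuneoEckmannHairerReyBellet2018, §3 eq. (3.4)] -/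
theorem lyapunovWeightedDensitySobolev₂_of_malliavinWeights (hMW : MalliavinIBPWeights₂) :
    LyapunovWeightedDensitySobolev₂ :=
  lyapunovWeightedDensitySobolev₂_of_scoreDual (densityScoreDualBound₂_of_malliavinWeights hMW)

/-- **★★ S3 ⟸ (Dˢ) ∧ (MW₂)**: the kernel temperature-Lipschitz bound from the Duhamel formula and
the Malliavin integration-by-parts interface. [cite: CuneoEckmannHairerReyBellet2018, Prop. 3.2] -/
theorem kernelTemperatureLipschitz_of_malliavinWeights (hD : KernelTemperatureDuhamelSmooth)
    (hMW : MalliavinIBPWeights₂) : KernelTemperatureLipschitz :=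
  kernelTemperatureLipschitz_of_scoreDual hD (densityScoreDualBound₂_of_malliavinWeights hMW)

/-- **Junction K_fix ⟸ A0 ∧ A2 ∧ (Dˢ) ∧ (MW₂) ∧ A3p ∧ A4.**
[cite: CuneoEckmannHairerReyBellet2018, Prop. 3.2] -/
theorem snapshotKLUpperExpansion_of_atoms₆MW (h0 : NessGibbsReweighting)
    (h2 : NessOddLogRatioBound) (hD : KernelTemperatureDuhamelSmooth)
    (hMW : MalliavinIBPWeights₂) (h3p : NessFloorMeanValue) (h4 : NessLinearResponseL2) :
    SnapshotKLUpperExpansion :=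
  snapshotKLUpperExpansion_of_atoms₆SD h0 h2 hD (densityScoreDualBound₂_of_malliavinWeights hMW)
    h3p h4

end Summit.AtomisticToContinuum.FouriersLaw.Theorems.ExtensiveSnapshotIrreversibility.EnergyWindow

end
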